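import Summits.ResolutionOfSingularities.ResolutionOfSingularities.Theorems.UniversalCellsCampaignW82KollarCurveAnyField
import Literature.AlgebraicGeometry.Resolution.AffineBlowupRegular
import Literature.AlgebraicGeometry.Resolution.AffineBlowupResolutionCriterion
import Literature.AlgebraicGeometry.Resolution.BlowupChartPair
import Mathlib.RingTheory.Regular.RegularSequence
import HarnessLib

/-!
# [OURS · L1 W8.2] SELECTION IS NECESSARY, I — the blow-up of the plane `𝔸²_{k(t)}` at the inseparable point
# `(Y, X^p − t)`: a REGULAR resolution of a SMOOTH surface, and its chart `Y T = X^p − t`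

Cell `res-hironaka` (run/shared/lean/pub/res-hironaka/), LADDER-RESOLUTION rung L (RESCUE), slot W8.2, host route
`UniversalCells`, host item `PrimeFieldToPerfect` (stmt-ResolutionOfSingularities-15233); door 2
`UniformComplexity.PrimeModelTransfer` (stmt-8933). Written by the slot's prover res-L1-s82-pv-1 (gen 3). Support
OBJECTS with bodies + proved lemmas (Theses-free); the headline is in the sibling
Theorems/UniversalCellsCampaignW82SelectionNecessary.lean.

WHY. The crux documents diagnose the W8.2 residual (`CampaignW82.PerfectionStepAt M n`, `n ≥ 4`) as needing
(i) a Frobenius TWIST (certified: `not_smoothModelStepRegularAt_one`, Theorems/…ExponentZeroAnyField.lean) and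
(ii) a SELECTION of the resolution after twisting — STRATEGY-CENSUS N2 («blind "resolve – p-th root – re-resolve"
provably cannot be a proof: an adversarial resolution re-creates an inseparable closed point at every level») /
Disproof.lean §4 (s5) («blowing up `𝔸²_K` at the closed point `(x^p − t, y)` creates a regular NON-smooth point;
a proof must SELECT resolutions; candidate Lean lemma»). This file and its sibling certify (ii) at scheme level:
the blow-up `Bl ⟶ 𝔸²_{k(t)}` of the SMOOTH plane at the inseparable closed point `(Y, X^p − t)` is a resolution
of singularities (proper, birational, `Bl` REGULAR) whose source is NOT smooth over `k(t)` — so in the residual's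
normal form «∃ (e, Y → X₀^{(p^e)}) proper birational with Y smooth» the resolution `Y` cannot be replaced by
«every resolution», even at a level where a smooth model exists.

CONTENT (over `R = k(t)[Y, X] = MvPolynomial (Fin 2) (RatFunc k)`, `Y = X 0`, `X = X 1`; `k` any field, `p` prime;
the purely inseparable field `extField k p = k(t)(t^{1/p})` from …KollarCurveAnyField.lean):
* `centreGen k p = ![Y, X^p − t]`, `centre k p = (Y, X^p − t)`; `isWeaklyRegular_centreGen` (a regular pair:
  `X_zero_dvd_of_dvd_mul`), `centreQuotientEquiv : R/(Y, X^p − t) ≃ₐ k(t)(t^{1/p})` (a field),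
  `isRegularRing_quotient_centre`;
* `isRegular_blowup` — `Bl_{(Y, X^p − t)}(𝔸²)` is a REGULAR scheme (Liu 8.1.19 (a), tree
  `affineBlowup.isRegular_of_isWeaklyRegular`); `isResolution_blowupπ` — `Bl ⟶ 𝔸²` is proper and birational with
  regular source (tree `affineBlowup.isResolution_of_mem_nonZeroDivisors`);
* the chart at `Y`: `chartPoly k p = Y T − (X^p − t) ∈ k(t)[T, Y, X]`, `blowupAlgebra_eq_range` (`R[I/Y] = R[(X^p−t)/Y]`),
  `chartQuotToBlowupAlgebra` (bijective: Stacks 0BIQ via tree `BlowupChartPair.ker_chartEval`) and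
  **`chartIso : (R[It])_{(Yt)} ≃+* k(t)[T,Y,X]/(Y T − (X^p − t))`** with `chartIso_reesChartBase_C` (compatible with
  the constants `k(t)`).

HONEST FRAMING. OURS support (witness objects for a tightness certificate); the geometry is folklore (Kollár 2007,
1.19; Liu 2002, 8.1.19; Stacks 0BIQ/052P); nothing here is a statement of H. Hironaka's manuscript [Hironaka2017] and
nothing is attributed to its author. No `sorry`, no new axioms; the two `instance`s concern the new cusp ideal only.
AI work, weaker than expert review.

## References (locators)
* Q. Liu, *Algebraic Geometry and Arithmetic Curves* (2002), Thm. 8.1.19 (a); Ex. 7.3.15. [Liu2002]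
* The Stacks Project, Tags 0BIQ, 052P (affine blowup algebras of a regular pair). [StacksProject]
* J. Kollár, *Lectures on Resolution of Singularities* (2007), 1.19. [Kollar2007]
* Cruxes/PrimeFieldToPerfect/STRATEGY-CENSUS.md N2; Disproof.lean §4 (s5) — cell files, OURS.
-/

noncomputable section

set_option linter.dupNamespace false -- mandated namespace of this single-conjunct summit

open Polynomial IsLocalRing TensorProduct Pointwise
open _root_.CategoryTheory _root_.CategoryTheory.Limits _root_.AlgebraicGeometry
open Literature.AlgebraicGeometry.Resolution

namespace Summit.ResolutionOfSingularities.ResolutionOfSingularities.Theorems.CampaignW82.SelectionWitness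

open KollarCurveAnyField (insepPoly extField X_ne_pow irreducible_insepPoly root_pow_eq)

section Plane

variable (k : Type) [Field k] (p : ℕ) [hp : Fact p.Prime]

/-- The centre's generators in `k(t)[Y, X]` (`Y = X 0`, `X = X 1`): the regular pair `(Y, X^p − t)`. -/
def centreGen : Fin 2 → MvPolynomial (Fin 2) (RatFunc k) :=
  ![MvPolynomial.X 0, MvPolynomial.X 1 ^ p - MvPolynomial.C RatFunc.X]

omit hp in
/-- `centreGen 0 = Y`. -/
@[simp] theorem centreGen_zero : centreGen k p 0 = MvPolynomial.X 0 := rfl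

omit hp in
/-- `centreGen 1 = X^p − t`. -/
@[simp] theorem centreGen_one : centreGen k p 1 = MvPolynomial.X 1 ^ p - MvPolynomial.C RatFunc.X := rfl

omit hp in
/-- Under the slicing `k(t)[Y,X] ≃ k(t)[X][Y]` (`finSuccEquiv`: `X 0 ↦ Y`, `X 1 ↦ C X`), `X^p − t ↦ C (X^p − t)`. -/
theorem finSuccEquiv_centreGen_one :
    MvPolynomial.finSuccEquiv (RatFunc k) 1 (centreGen k p 1) =
      Polynomial.C (MvPolynomial.X 0 ^ p - MvPolynomial.C RatFunc.X) := by
  have h1 : (1 : Fin 2) = Fin.succ 0 := rfl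
  rw [centreGen_one, map_sub, map_pow, h1, MvPolynomial.finSuccEquiv_X_succ, MvPolynomial.finSuccEquiv_apply,
    MvPolynomial.eval₂Hom_C]
  simp

/-- `X^p − t ≠ 0` in one variable. -/
theorem inner_ne_zero : (MvPolynomial.X 0 ^ p - MvPolynomial.C RatFunc.X : MvPolynomial (Fin 1) (RatFunc k)) ≠ 0 := by
  intro h
  have := congrArg (MvPolynomial.eval fun _ => (0 : RatFunc k)) h
  simp [hp.out.ne_zero] at this
  exact RatFunc.X_ne_zero this

/-- `Y ∣ r · (X^p − t) ⇒ Y ∣ r` (the pair is regular). -/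
theorem X_zero_dvd_of_dvd_mul (r : MvPolynomial (Fin 2) (RatFunc k)) (h : MvPolynomial.X 0 ∣ r * centreGen k p 1) :
    MvPolynomial.X 0 ∣ r := by
  rcases MvPolynomial.X_dvd_mul_iff.mp h with h' | h'
  · exact h'
  · exfalso
    obtain ⟨c, hc⟩ := h'
    have h2 := congrArg (MvPolynomial.finSuccEquiv (RatFunc k) 1) hc
    rw [finSuccEquiv_centreGen_one, map_mul, MvPolynomial.finSuccEquiv_X_zero] at h2
    have h3 := congrArg (Polynomial.coeff · 0) h2
    simp only [Polynomial.coeff_C_zero, Polynomial.coeff_X_mul_zero] at h3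
    exact inner_ne_zero k p h3

/-- `(Y, X^p − t)` is a weakly regular sequence on `k(t)[Y,X]`. -/
theorem isWeaklyRegular_centreGen :
    RingTheory.Sequence.IsWeaklyRegular (MvPolynomial (Fin 2) (RatFunc k)) (List.ofFn (centreGen k p)) := by
  rw [List.ofFn_succ, List.ofFn_succ, List.ofFn_zero]
  simp only [Fin.succ_zero_eq_one]
  rw [RingTheory.Sequence.isWeaklyRegular_cons_iff, RingTheory.Sequence.isWeaklyRegular_singleton_iff]
  refine ⟨?_, ?_⟩
  · rw [isSMulRegular_iff_right_eq_zero_of_smul]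
    intro m hm
    rw [centreGen_zero, smul_eq_mul] at hm
    exact (mul_eq_zero.mp hm).resolve_left (MvPolynomial.X_ne_zero 0)
  · rw [isSMulRegular_iff_right_eq_zero_of_smul]
    intro m hm
    obtain ⟨s, rfl⟩ := Submodule.Quotient.mk_surjective _ m
    rw [← Submodule.Quotient.mk_smul, Submodule.Quotient.mk_eq_zero, smul_eq_mul] at hm
    rw [Submodule.Quotient.mk_eq_zero]
    rw [centreGen_zero] at hm ⊢
    have key : ∀ z : MvPolynomial (Fin 2) (RatFunc k),
        z ∈ (MvPolynomial.X 0 : MvPolynomial (Fin 2) (RatFunc k)) •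
          (⊤ : Submodule (MvPolynomial (Fin 2) (RatFunc k)) (MvPolynomial (Fin 2) (RatFunc k))) ↔
          MvPolynomial.X 0 ∣ z := by
      intro z
      rw [Submodule.mem_smul_pointwise_iff_exists]
      constructor
      · rintro ⟨n, -, rfl⟩
        exact ⟨n, by rw [smul_eq_mul]⟩
      · rintro ⟨n, rfl⟩
        exact ⟨n, Submodule.mem_top, by rw [smul_eq_mul]⟩
    rw [key] at hm ⊢
    exact X_zero_dvd_of_dvd_mul k p s (by rw [mul_comm]; exact hm)

/-- The centre `I = (Y, X^p − t) ⊂ k(t)[Y, X]`: the ideal of the inseparable closed point `(X^p = t, Y = 0)`. -/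
abbrev centre : Ideal (MvPolynomial (Fin 2) (RatFunc k)) := Ideal.span (Set.range (centreGen k p))

omit hp in
/-- `Y ∈ I`. -/
theorem X_zero_mem_centre : (MvPolynomial.X 0 : MvPolynomial (Fin 2) (RatFunc k)) ∈ centre k p :=
  Ideal.subset_span ⟨0, rfl⟩

omit hp in
/-- `X^p − t ∈ I`. -/
theorem centreGen_one_mem_centre : centreGen k p 1 ∈ centre k p := Ideal.subset_span ⟨1, rfl⟩

/-- The point `k(t)[Y,X] → K = k(t)(t^{1/p})`, `Y ↦ 0`, `X ↦ t^{1/p}`. -/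
def pointHom' : MvPolynomial (Fin 2) (RatFunc k) →ₐ[RatFunc k] extField k p :=
  MvPolynomial.aeval ![0, AdjoinRoot.root (insepPoly k p)]

/-- It kills the centre. -/
theorem pointHom'_centre_le : centre k p ≤ RingHom.ker (pointHom' k p).toRingHom := by
  rw [Ideal.span_le]
  rintro _ ⟨i, rfl⟩
  fin_cases i
  · simp [pointHom']
  · simp [pointHom', root_pow_eq]

/-- **`k(t)[Y,X]/(Y, X^p − t) ≅ k(t)(t^{1/p})`**, a field. -/
def centreQuotientEquiv : (MvPolynomial (Fin 2) (RatFunc k) ⧸ centre k p) ≃ₐ[RatFunc k] extField k p := by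
  refine AlgEquiv.ofAlgHom (Ideal.Quotient.liftₐ (centre k p) (pointHom' k p)
      (fun a ha => pointHom'_centre_le k p ha))
    (AdjoinRoot.liftAlgHom (insepPoly k p) (Algebra.ofId (RatFunc k) _)
      (Ideal.Quotient.mk (centre k p) (MvPolynomial.X 1)) ?_) ?_ ?_
  · -- `(X̄)^p − t = 0` in the quotient
    simp only [insepPoly, eval₂_sub, eval₂_X_pow, eval₂_C]
    have h : ((Algebra.ofId (RatFunc k) (MvPolynomial (Fin 2) (RatFunc k) ⧸ centre k p) :
        RatFunc k →+* MvPolynomial (Fin 2) (RatFunc k) ⧸ centre k p) RatFunc.X) =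
        Ideal.Quotient.mk (centre k p) (MvPolynomial.C RatFunc.X) := rfl
    rw [h, ← map_pow, ← map_sub, Ideal.Quotient.eq_zero_iff_mem]
    exact centreGen_one_mem_centre k p
  · refine AdjoinRoot.algHom_ext ?_
    simp [AdjoinRoot.liftAlgHom_root, pointHom']
  · refine Ideal.Quotient.algHom_ext _ (MvPolynomial.algHom_ext fun i => ?_)
    fin_cases i
    · have h0 : Ideal.Quotient.mk (centre k p) (MvPolynomial.X 0) = 0 :=
        Ideal.Quotient.eq_zero_iff_mem.mpr (X_zero_mem_centre k p)
      simp [pointHom', h0]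
    · simp [pointHom', AdjoinRoot.liftAlgHom_root]

/-- Hence the quotient is a regular ring (a field). -/
theorem isRegularRing_quotient_centre :
    IsRegularRing (MvPolynomial (Fin 2) (RatFunc k) ⧸ Ideal.span (Set.range (centreGen k p))) :=
  IsRegularRing.of_ringEquiv (R := extField k p) (centreQuotientEquiv k p).symm.toRingEquiv

/-- **The blow-up of the plane `𝔸²_{k(t)}` at the inseparable point `(Y, X^p − t)` is a REGULAR scheme** (Liu
8.1.19 (a) via the tree's `affineBlowup.isRegular_of_isWeaklyRegular`: regular pair with regular — indeed
field — quotient). -/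
theorem isRegular_blowup : Scheme.IsRegular (affineBlowup (centre k p)) :=
  haveI := isRegularRing_quotient_centre k p
  affineBlowup.isRegular_of_isWeaklyRegular (centreGen k p) (isWeaklyRegular_centreGen k p)

/-- … and `Bl → 𝔸²` is a resolution of singularities of the (smooth!) plane: proper, birational, regular source. -/
theorem isResolution_blowupπ : IsResolution (affineBlowup.π (centre k p)) :=
  affineBlowup.isResolution_of_mem_nonZeroDivisors (IsNoetherian.noetherian _) (X_zero_mem_centre k p)
    (mem_nonZeroDivisors_of_ne_zero (MvPolynomial.X_ne_zero 0)) (isRegular_blowup k p)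

/-! ### The chart at `Y` of the blow-up: `k(t)[Y,X][I/Y] ≅ k(t)[T, Y, X]/(Y·T − (X^p − t))` -/

/-- The chart hypersurface `T·Y − (X^p − t) ∈ k(t)[T, Y, X]` (`T = X 0`, `Y = X 1`, `X = X 2`). -/
def chartPoly : MvPolynomial (Fin 3) (RatFunc k) :=
  MvPolynomial.X 1 * MvPolynomial.X 0 - (MvPolynomial.X 2 ^ p - MvPolynomial.C RatFunc.X)

omit hp in
/-- Under `k(t)[T,Y,X] ≃ k(t)[Y,X][T]` (`finSuccEquiv _ 2`), the chart hypersurface is `C(Y)·T − C(X^p − t)`. -/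
theorem finSuccEquiv_chartPoly :
    MvPolynomial.finSuccEquiv (RatFunc k) 2 (chartPoly k p) =
      Polynomial.C (centreGen k p 0) * Polynomial.X - Polynomial.C (centreGen k p 1) := by
  have h1 : (1 : Fin 3) = Fin.succ 0 := rfl
  have h2 : (2 : Fin 3) = Fin.succ 1 := rfl
  rw [chartPoly, map_sub, map_mul, map_sub, map_pow, h1, h2, MvPolynomial.finSuccEquiv_X_succ,
    MvPolynomial.finSuccEquiv_X_succ, MvPolynomial.finSuccEquiv_X_zero, centreGen_zero, centreGen_one,
    map_sub, map_pow]
  congr 2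
  rw [MvPolynomial.finSuccEquiv_apply, MvPolynomial.eval₂Hom_C]
  simp

omit hp in
/-- The affine blowup algebra `k(t)[Y,X][I/Y] ⊆ k(t)[Y,X][1/Y]` is the range of the chart evaluation
`T ↦ (X^p − t)/Y` (it is generated by `I/Y = {1, (X^p − t)/Y}`). -/
theorem blowupAlgebra_eq_range :
    (blowupAlgebra (centre k p) (MvPolynomial.X 0)) =
      (BlowupChartPair.chartEval (MvPolynomial.X 0 : MvPolynomial (Fin 2) (RatFunc k)) (centreGen k p 1)).range := by
  apply le_antisymm
  · refine Algebra.adjoin_le ?_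
    rintro _ ⟨x, hx, rfl⟩
    obtain ⟨r, s, rfl⟩ := Ideal.mem_span_pair.mp (by
      have : Set.range (centreGen k p) = {centreGen k p 0, centreGen k p 1} := by
        ext y; simp [Fin.exists_fin_two, Set.mem_insert_iff, eq_comm]
      rw [centre, this] at hx
      exact hx)
    rw [centreGen_zero, map_add, map_mul, map_mul, add_mul, mul_assoc, IsLocalization.Away.mul_invSelf, mul_one,
      mul_assoc]
    refine Subalgebra.add_mem _ (Subalgebra.algebraMap_mem _ r) (Subalgebra.mul_mem _ (Subalgebra.algebraMap_mem _ s) ?_)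
    refine ⟨Polynomial.X, ?_⟩
    change BlowupChartPair.chartEval _ _ Polynomial.X = _
    rw [BlowupChartPair.chartEval, Polynomial.aeval_X, IsLocalization.Away.invSelf, ← IsLocalization.mk'_eq_mul_mk'_one]
  · rw [BlowupChartPair.chartEval, ← Algebra.adjoin_singleton_eq_range_aeval]
    refine Algebra.adjoin_le (Set.singleton_subset_iff.mpr ?_)
    rw [IsLocalization.mk'_eq_mul_mk'_one]
    exact div_mem_blowupAlgebra (centre k p) (MvPolynomial.X 0) (centreGen_one_mem_centre k p)

/-- The quotient map `k(t)[Y,X][T]/(Y T − (X^p − t)) → k(t)[Y,X][I/Y]`, `T ↦ (X^p − t)/Y` (lift of the chart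
evaluation, restricted to its range = the affine blowup algebra). -/
def chartQuotToBlowupAlgebra :
    (Polynomial (MvPolynomial (Fin 2) (RatFunc k)) ⧸
        Ideal.span {Polynomial.C (centreGen k p 0) * Polynomial.X - Polynomial.C (centreGen k p 1)}) →+*
      blowupAlgebra (centre k p) (MvPolynomial.X 0) :=
  (Ideal.Quotient.lift _ (BlowupChartPair.chartEval (MvPolynomial.X 0 : MvPolynomial (Fin 2) (RatFunc k))
      (centreGen k p 1)).toRingHom (fun g hg => by
        rw [← RingHom.mem_ker, BlowupChartPair.ker_chartEval _ _ (mem_nonZeroDivisors_of_ne_zero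
          (MvPolynomial.X_ne_zero 0)) (X_zero_dvd_of_dvd_mul k p)]
        simpa only [centreGen_zero] using hg)).codRestrict (blowupAlgebra (centre k p) (MvPolynomial.X 0)) (fun g => by
      obtain ⟨g, rfl⟩ := Ideal.Quotient.mk_surjective g
      rw [Ideal.Quotient.lift_mk, blowupAlgebra_eq_range]
      exact ⟨g, rfl⟩)

/-- Evaluation of the chart map on a class: the chart evaluation of a representative. -/
theorem chartQuotToBlowupAlgebra_mk (g : Polynomial (MvPolynomial (Fin 2) (RatFunc k))) :
    (chartQuotToBlowupAlgebra k p (Ideal.Quotient.mk _ g) : Localization.Away (MvPolynomial.X 0 :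
      MvPolynomial (Fin 2) (RatFunc k))) =
      BlowupChartPair.chartEval (MvPolynomial.X 0 : MvPolynomial (Fin 2) (RatFunc k)) (centreGen k p 1) g :=
  rfl

/-- It is bijective (kernel `(Y T − (X^p − t))` by the regular-pair computation `BlowupChartPair.ker_chartEval`;
onto by `blowupAlgebra_eq_range`). -/
theorem chartQuotToBlowupAlgebra_bijective : Function.Bijective (chartQuotToBlowupAlgebra k p) := by
  constructor
  · intro x y hxy
    obtain ⟨x, rfl⟩ := Ideal.Quotient.mk_surjective x
    obtain ⟨y, rfl⟩ := Ideal.Quotient.mk_surjective y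
    have h : BlowupChartPair.chartEval (MvPolynomial.X 0 : MvPolynomial (Fin 2) (RatFunc k)) (centreGen k p 1) x =
        BlowupChartPair.chartEval (MvPolynomial.X 0 : MvPolynomial (Fin 2) (RatFunc k)) (centreGen k p 1) y := by
      rw [← chartQuotToBlowupAlgebra_mk, ← chartQuotToBlowupAlgebra_mk, hxy]
    rw [Ideal.Quotient.eq]
    change x - y ∈ Ideal.span {Polynomial.C (MvPolynomial.X 0 : MvPolynomial (Fin 2) (RatFunc k)) * Polynomial.X -
      Polynomial.C (centreGen k p 1)}
    rw [← BlowupChartPair.ker_chartEval _ _ (mem_nonZeroDivisors_of_ne_zero (MvPolynomial.X_ne_zero 0))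
      (X_zero_dvd_of_dvd_mul k p), RingHom.mem_ker, map_sub, sub_eq_zero]
    exact h
  · rintro ⟨z, hz⟩
    rw [blowupAlgebra_eq_range] at hz
    obtain ⟨g, rfl⟩ := hz
    exact ⟨Ideal.Quotient.mk _ g, Subtype.ext (chartQuotToBlowupAlgebra_mk k p g)⟩

/-- On constants: `T ↦ …` sends the class of `C r` to `r/1`. -/
theorem chartQuotToBlowupAlgebra_mk_C (r : MvPolynomial (Fin 2) (RatFunc k)) :
    chartQuotToBlowupAlgebra k p (Ideal.Quotient.mk _ (Polynomial.C r)) =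
      algebraMap (MvPolynomial (Fin 2) (RatFunc k)) (blowupAlgebra (centre k p) (MvPolynomial.X 0)) r := by
  apply Subtype.ext
  rw [chartQuotToBlowupAlgebra_mk, BlowupChartPair.chartEval_C]
  rfl

omit hp in
/-- `(Y T − (X^p − t)) ⊂ k(t)[Y,X][T]` corresponds to `(chartPoly) ⊂ k(t)[T,Y,X]` under `finSuccEquiv`. -/
theorem span_chartPoly_eq_map :
    Ideal.span {chartPoly k p} =
      (Ideal.span {Polynomial.C (centreGen k p 0) * Polynomial.X - Polynomial.C (centreGen k p 1)}).map
        ((MvPolynomial.finSuccEquiv (RatFunc k) 2).symm.toRingEquiv :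
          Polynomial (MvPolynomial (Fin 2) (RatFunc k)) →+* MvPolynomial (Fin 3) (RatFunc k)) := by
  rw [Ideal.map_span, Set.image_singleton, ← finSuccEquiv_chartPoly]
  congr 2
  exact ((MvPolynomial.finSuccEquiv (RatFunc k) 2).symm_apply_apply (chartPoly k p)).symm

/-- **The chart at `Y` of the blow-up of `𝔸²_{k(t)}` at `(Y, X^p − t)` is the hypersurface `Y T = X^p − t` in
`𝔸³_{k(t)}`**: `(R[It])_{(Yt)} ≅ R[I/Y] ≅ R[T]/(Y T − (X^p − t)) ≅ k(t)[T,Y,X]/(chartPoly)` (`R = k(t)[Y,X]`;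
tree `reesChartEquiv`, `BlowupChartPair.ker_chartEval`, Mathlib `finSuccEquiv`). -/
def chartIso :
    HomogeneousLocalization.Away (reesGrading (centre k p)) (reesT (MvPolynomial.X 0) (X_zero_mem_centre k p)) ≃+*
      MvPolynomial (Fin 3) (RatFunc k) ⧸ Ideal.span {chartPoly k p} :=
  ((reesChartEquiv (I := centre k p) (MvPolynomial.X 0) (X_zero_mem_centre k p)).trans
    (RingEquiv.ofBijective (chartQuotToBlowupAlgebra k p) (chartQuotToBlowupAlgebra_bijective k p)).symm).trans
    (Ideal.quotientEquiv _ _ (MvPolynomial.finSuccEquiv (RatFunc k) 2).symm.toRingEquiv (span_chartPoly_eq_map k p))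

/-- `chartIso` is compatible with the structure maps from `k(t)`: `chartIso (c/1) = c̄`. -/
theorem chartIso_reesChartBase_C (c : RatFunc k) :
    chartIso k p (reesChartBase (I := centre k p) (MvPolynomial.X 0) (X_zero_mem_centre k p) (MvPolynomial.C c)) =
      algebraMap (RatFunc k) (MvPolynomial (Fin 3) (RatFunc k) ⧸ Ideal.span {chartPoly k p}) c := by
  rw [chartIso, RingEquiv.trans_apply, RingEquiv.trans_apply, reesChartEquiv_reesChartBase]
  have h1 : (RingEquiv.ofBijective (chartQuotToBlowupAlgebra k p) (chartQuotToBlowupAlgebra_bijective k p)).symm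
      (algebraMap (MvPolynomial (Fin 2) (RatFunc k)) (blowupAlgebra (centre k p) (MvPolynomial.X 0))
        (MvPolynomial.C c)) =
      Ideal.Quotient.mk _ (Polynomial.C (MvPolynomial.C c)) := by
    rw [RingEquiv.symm_apply_eq, RingEquiv.ofBijective_apply, chartQuotToBlowupAlgebra_mk_C]
  rw [h1, Ideal.quotientEquiv_mk]
  change Ideal.Quotient.mk _ ((MvPolynomial.finSuccEquiv (RatFunc k) 2).symm (Polynomial.C (MvPolynomial.C c))) = _
  have h2 : (MvPolynomial.finSuccEquiv (RatFunc k) 2).symm (Polynomial.C (MvPolynomial.C c)) = MvPolynomial.C c :=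
    RingHom.congr_fun (MvPolynomial.finSuccEquiv_comp_C_eq_C (R := RatFunc k) 2) c
  rw [h2]
  rfl


end Plane

end Summit.ResolutionOfSingularities.ResolutionOfSingularities.Theorems.CampaignW82.SelectionWitness

end
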